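import Mathlib
import Summits.ValiantsHypothesis.ValiantsHypothesis.Theorems.FreeSubtorusSubtorusCoveringStubTorusExtension

/-!
# Crux `FreeSubtorus.OrbitDimensionBound` (stmt-ValiantsHypothesis-16133), registered line
`Cruxes/OrbitDimensionBound/Lines/affine_multiple.lean`, stub 2 `stub_absorbingSacrifice` —
branch (β): the floor's torus extension made EXPLICIT, and the PIN CONSTRAINTS as characters
(helper; the stub stays OPEN)

The floor's `FreeSubtorusSubtorusCovering.stub_torusExtension` (crux 16134, line pair-sacrifice,
registered stub 3) extends `N`-th powers of the free torus across the sacrificed diagonal pairs: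
given integer coefficients `ar k`, `ac l : Fin s → ℤ` writing `N` times every free column of `Λ` as a
combination of the sacrificed differences `v_j = Λ(·)(inl (natAdd j)) - Λ(·)(inr (natAdd j))`, the
element `d = (d'^N, A⁻¹)`, `e = (e'^N, A)` with `A j = ∏_k d'_k^{ar k j} · ∏_l e'_l^{ac l j}` lies in
`T_Λ` and has `d_j e_j = 1` on the sacrificed diagonal.  Its statement hides `A` behind `∃`.  For the
ABSORBING sacrifice of stub 2 (branch (β), one pinned constant `u₀` at an off-free position `p₀`;
transport lemmas `…StubAbsorbingSacrificePin.lean` p579596, `…StubAbsorbingSacrificeLifts.lean`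
p580173) the lift through the substitution needs the extension to satisfy ONE MORE equation
`d_{p₀.1} e_{p₀.2} = 1`, and whether it does is decided by the explicit `A`:

* `torusExtension_explicit` — the floor's extension with `A` in the statement (same proof, via the
  floor's public `stub_torusExtension_relation`);
* `torusExtension_pin_sacRow_freeCol` — pin at `(natAdd j₀, castAdd l₀)`: the extension satisfies the
  pinned equation iff `e'_{l₀}^N = A j₀`, a CHARACTER condition on `(d', e')`;
  `torusExtension_pin_freeRow_sacCol` — pin at `(castAdd k₀, natAdd j₀)`: `d'_{k₀}^N · A j₀ = 1`;
  `torusExtension_pin_offDiag` — pin at `(natAdd j₀, natAdd j₁)`: `A j₀ = A j₁`;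
* `exists_roots_prod_eq_one` — `N`-th roots of a `T¹`-generator (`∏ d' ∏ e' = 1`) with product
  EXACTLY `1` (the root bookkeeping the rigid case needs: its character is a power of `∏ dr ∏ er`).

So in every branch the free generators that lift for the pinned substitution are those in the
kernel of ONE explicit character `χ_{Λ, M, p₀}` of the free torus (up to the `N`-th-root
bookkeeping of the floor's assembly); the card's case (c) / the re-matching analysis of stub 2 is
exactly the claim that in the rigid configuration this kernel contains the per-invariant torus
`T¹ = torusGen n' 1 𝟙` — that EXTENSION ANALYSIS is NOT done here and is what remains of the stub.
Honest framing: helper plumbing; `stub_absorbingSacrifice`, crux 16133 and route FreeSubtorus stay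
OPEN; census-neutral; `VP ≠ VNP` is NOT proved.

References: `Theorems/FreeSubtorusSubtorusCoveringStubTorusExtension.lean` (floor, by name);
[cite: LandsbergRessayre2017, Thm. 2.8, §6].
-/

open Finset

set_option linter.dupNamespace false

namespace Summit.ValiantsHypothesis.ValiantsHypothesis.Theorems.FreeSubtorusOrbitDimensionBound.AbsorbingSacrifice

open Summit.ValiantsHypothesis.ValiantsHypothesis.Theorems.FreeSubtorusSubtorusCovering
  (stub_torusExtension_relation)

/-- **The floor's torus extension, explicit.**  With coefficients `ar`, `ac` expressing `N` times the
free columns of `Λ` through the sacrificed differences, and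
`A j = ∏_k d'_k^{ar k j} · ∏_l e'_l^{ac l j}`, the pair `d = (d'^N, A⁻¹)`, `e = (e'^N, A)` (free
coordinates first, `Fin.append`) satisfies every `Λ`-relation; its free coordinates are the `N`-th
powers and its sacrificed coordinates are `(A j)⁻¹`, `A j` (so `d_j e_j = 1` there).
[cite: LandsbergRessayre2017, §6] -/
theorem torusExtension_explicit (n' s r : ℕ) (Λ : Fin r → (Fin (n' + s) ⊕ Fin (n' + s)) → ℤ)
    (N : ℕ) (ar ac : Fin n' → Fin s → ℤ)
    (har : ∀ k i, (N : ℤ) * Λ i (Sum.inl (Fin.castAdd s k)) =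
      ∑ j, ar k j * (Λ i (Sum.inl (Fin.natAdd n' j)) - Λ i (Sum.inr (Fin.natAdd n' j))))
    (hac : ∀ l i, (N : ℤ) * Λ i (Sum.inr (Fin.castAdd s l)) =
      ∑ j, ac l j * (Λ i (Sum.inl (Fin.natAdd n' j)) - Λ i (Sum.inr (Fin.natAdd n' j))))
    (d' e' : Fin n' → ℂˣ) :
    (∀ i, (∏ k, (Fin.append (fun k => d' k ^ N)
        (fun j => ((∏ k, d' k ^ ar k j) * (∏ l, e' l ^ ac l j))⁻¹) k) ^ (Λ i (Sum.inl k))) *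
      (∏ l, (Fin.append (fun l => e' l ^ N)
        (fun j => (∏ k, d' k ^ ar k j) * (∏ l, e' l ^ ac l j)) l) ^ (Λ i (Sum.inr l))) = 1) ∧
    (∀ k, Fin.append (fun k => d' k ^ N)
        (fun j => ((∏ k, d' k ^ ar k j) * (∏ l, e' l ^ ac l j))⁻¹) (Fin.castAdd s k) = d' k ^ N) ∧
    (∀ l, Fin.append (fun l => e' l ^ N)
        (fun j => (∏ k, d' k ^ ar k j) * (∏ l, e' l ^ ac l j)) (Fin.castAdd s l) = e' l ^ N) ∧
    (∀ j, Fin.append (fun k => d' k ^ N)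
        (fun j => ((∏ k, d' k ^ ar k j) * (∏ l, e' l ^ ac l j))⁻¹) (Fin.natAdd n' j) =
          ((∏ k, d' k ^ ar k j) * (∏ l, e' l ^ ac l j))⁻¹) ∧
    (∀ j, Fin.append (fun l => e' l ^ N)
        (fun j => (∏ k, d' k ^ ar k j) * (∏ l, e' l ^ ac l j)) (Fin.natAdd n' j) =
          (∏ k, d' k ^ ar k j) * (∏ l, e' l ^ ac l j)) := by
  refine ⟨fun i => ?_, fun k => by simp only [Fin.append_left], fun l => by
    simp only [Fin.append_left], fun j => by simp only [Fin.append_right], fun j => by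
    simp only [Fin.append_right]⟩
  rw [Fin.prod_univ_add, Fin.prod_univ_add]
  simp only [Fin.append_left, Fin.append_right]
  exact stub_torusExtension_relation N d' e' _ _ _ _ ar ac (fun k => har k i) (fun l => hac l i)
    _ (fun _ => rfl)

/-- **Pin in a sacrificed row and a free column.**  If `e'_{l₀}^N = A j₀` (the character condition of
the pin `p₀ = (natAdd j₀, castAdd l₀)`), the explicit extension ALSO satisfies
`d_{natAdd j₀} · e_{castAdd l₀} = 1`, besides the `Λ`-relations, the free `N`-th powers and
`d_j e_j = 1` on the sacrificed diagonal. [cite: LandsbergRessayre2017, §6] -/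
theorem torusExtension_pin_sacRow_freeCol (n' s r : ℕ)
    (Λ : Fin r → (Fin (n' + s) ⊕ Fin (n' + s)) → ℤ) (N : ℕ) (ar ac : Fin n' → Fin s → ℤ)
    (har : ∀ k i, (N : ℤ) * Λ i (Sum.inl (Fin.castAdd s k)) =
      ∑ j, ar k j * (Λ i (Sum.inl (Fin.natAdd n' j)) - Λ i (Sum.inr (Fin.natAdd n' j))))
    (hac : ∀ l i, (N : ℤ) * Λ i (Sum.inr (Fin.castAdd s l)) =
      ∑ j, ac l j * (Λ i (Sum.inl (Fin.natAdd n' j)) - Λ i (Sum.inr (Fin.natAdd n' j))))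
    (d' e' : Fin n' → ℂˣ) (j₀ : Fin s) (l₀ : Fin n')
    (hχ : e' l₀ ^ N = (∏ k, d' k ^ ar k j₀) * (∏ l, e' l ^ ac l j₀)) :
    ∃ d e : Fin (n' + s) → ℂˣ,
      (∀ i, (∏ k, (d k) ^ (Λ i (Sum.inl k))) * (∏ l, (e l) ^ (Λ i (Sum.inr l))) = 1) ∧
      (∀ k, d (Fin.castAdd s k) = d' k ^ N) ∧ (∀ l, e (Fin.castAdd s l) = e' l ^ N) ∧
      (∀ j, d (Fin.natAdd n' j) * e (Fin.natAdd n' j) = 1) ∧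
      d (Fin.natAdd n' j₀) * e (Fin.castAdd s l₀) = 1 := by
  obtain ⟨hrel, hd, he, hds, hes⟩ := torusExtension_explicit n' s r Λ N ar ac har hac d' e'
  refine ⟨_, _, hrel, hd, he, fun j => ?_, ?_⟩
  · rw [hds, hes, inv_mul_cancel]
  · rw [hds, he, hχ, inv_mul_cancel]

/-- **Pin in a free row and a sacrificed column.**  If `d'_{k₀}^N · A j₀ = 1` (the character
condition of the pin `p₀ = (castAdd k₀, natAdd j₀)`), the explicit extension also satisfies
`d_{castAdd k₀} · e_{natAdd j₀} = 1`. [cite: LandsbergRessayre2017, §6] -/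
theorem torusExtension_pin_freeRow_sacCol (n' s r : ℕ)
    (Λ : Fin r → (Fin (n' + s) ⊕ Fin (n' + s)) → ℤ) (N : ℕ) (ar ac : Fin n' → Fin s → ℤ)
    (har : ∀ k i, (N : ℤ) * Λ i (Sum.inl (Fin.castAdd s k)) =
      ∑ j, ar k j * (Λ i (Sum.inl (Fin.natAdd n' j)) - Λ i (Sum.inr (Fin.natAdd n' j))))
    (hac : ∀ l i, (N : ℤ) * Λ i (Sum.inr (Fin.castAdd s l)) =
      ∑ j, ac l j * (Λ i (Sum.inl (Fin.natAdd n' j)) - Λ i (Sum.inr (Fin.natAdd n' j))))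
    (d' e' : Fin n' → ℂˣ) (k₀ : Fin n') (j₀ : Fin s)
    (hχ : d' k₀ ^ N * ((∏ k, d' k ^ ar k j₀) * (∏ l, e' l ^ ac l j₀)) = 1) :
    ∃ d e : Fin (n' + s) → ℂˣ,
      (∀ i, (∏ k, (d k) ^ (Λ i (Sum.inl k))) * (∏ l, (e l) ^ (Λ i (Sum.inr l))) = 1) ∧
      (∀ k, d (Fin.castAdd s k) = d' k ^ N) ∧ (∀ l, e (Fin.castAdd s l) = e' l ^ N) ∧
      (∀ j, d (Fin.natAdd n' j) * e (Fin.natAdd n' j) = 1) ∧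
      d (Fin.castAdd s k₀) * e (Fin.natAdd n' j₀) = 1 := by
  obtain ⟨hrel, hd, he, hds, hes⟩ := torusExtension_explicit n' s r Λ N ar ac har hac d' e'
  refine ⟨_, _, hrel, hd, he, fun j => ?_, ?_⟩
  · rw [hds, hes, inv_mul_cancel]
  · rw [hd, hes, hχ]

/-- **Pin at an off-diagonal position of the sacrificed block.**  If `A j₀ = A j₁` (the character
condition of the pin `p₀ = (natAdd j₀, natAdd j₁)`), the explicit extension also satisfies
`d_{natAdd j₀} · e_{natAdd j₁} = 1`. [cite: LandsbergRessayre2017, §6] -/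
theorem torusExtension_pin_offDiag (n' s r : ℕ)
    (Λ : Fin r → (Fin (n' + s) ⊕ Fin (n' + s)) → ℤ) (N : ℕ) (ar ac : Fin n' → Fin s → ℤ)
    (har : ∀ k i, (N : ℤ) * Λ i (Sum.inl (Fin.castAdd s k)) =
      ∑ j, ar k j * (Λ i (Sum.inl (Fin.natAdd n' j)) - Λ i (Sum.inr (Fin.natAdd n' j))))
    (hac : ∀ l i, (N : ℤ) * Λ i (Sum.inr (Fin.castAdd s l)) =
      ∑ j, ac l j * (Λ i (Sum.inl (Fin.natAdd n' j)) - Λ i (Sum.inr (Fin.natAdd n' j))))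
    (d' e' : Fin n' → ℂˣ) (j₀ j₁ : Fin s)
    (hχ : (∏ k, d' k ^ ar k j₀) * (∏ l, e' l ^ ac l j₀) =
      (∏ k, d' k ^ ar k j₁) * (∏ l, e' l ^ ac l j₁)) :
    ∃ d e : Fin (n' + s) → ℂˣ,
      (∀ i, (∏ k, (d k) ^ (Λ i (Sum.inl k))) * (∏ l, (e l) ^ (Λ i (Sum.inr l))) = 1) ∧
      (∀ k, d (Fin.castAdd s k) = d' k ^ N) ∧ (∀ l, e (Fin.castAdd s l) = e' l ^ N) ∧
      (∀ j, d (Fin.natAdd n' j) * e (Fin.natAdd n' j) = 1) ∧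
      d (Fin.natAdd n' j₀) * e (Fin.natAdd n' j₁) = 1 := by
  obtain ⟨hrel, hd, he, hds, hes⟩ := torusExtension_explicit n' s r Λ N ar ac har hac d' e'
  refine ⟨_, _, hrel, hd, he, fun j => ?_, ?_⟩
  · rw [hds, hes, inv_mul_cancel]
  · rw [hds, hes, hχ, inv_mul_cancel]

/-! ### `N`-th roots on the per-invariant torus with product exactly `1` -/

/-- **Root bookkeeping for `T¹`-targets.**  Over `ℂ`, if `∏ d' · ∏ e' = 1` (a generator of the
per-invariant torus `T¹`) and `0 < N`, `1 ≤ n'`, then `d'`, `e'` have `N`-th roots `dr`, `er` with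
`∏ dr · ∏ er = 1` EXACTLY (take any roots; their product `ω` is an `N`-th root of unity; divide one
root by `ω`).  In the rigid configuration of stub 2 the pin character is a power of `∏ dr · ∏ er`, so
these roots lie in its kernel. [folklore] -/
theorem exists_roots_prod_eq_one {n' N : ℕ} (hn' : 1 ≤ n') (hN : 0 < N) (d' e' : Fin n' → ℂˣ)
    (h : (∏ k, d' k) * (∏ l, e' l) = 1) :
    ∃ dr er : Fin n' → ℂˣ, (∀ k, dr k ^ N = d' k) ∧ (∀ l, er l ^ N = e' l) ∧
      (∏ k, dr k) * (∏ l, er l) = 1 := by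
  -- arbitrary `N`-th roots (ℂ is algebraically closed)
  have hroot : ∀ u : ℂˣ, ∃ v : ℂˣ, v ^ N = u := by
    intro u
    obtain ⟨z, hz⟩ := IsAlgClosed.exists_pow_nat_eq (u : ℂ) hN
    have hz0 : z ≠ 0 := fun h0 => u.ne_zero (by rw [← hz, h0, zero_pow hN.ne'])
    exact ⟨Units.mk0 z hz0, Units.ext (by simp [hz])⟩
  choose dr₀ hdr₀ using fun k => hroot (d' k)
  choose er her using fun l => hroot (e' l)
  -- the product of the roots is an `N`-th root of unity `ω`
  set ω : ℂˣ := (∏ k, dr₀ k) * (∏ l, er l) with hω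
  have hωN : ω ^ N = 1 := by
    rw [hω, mul_pow, ← Finset.prod_pow, ← Finset.prod_pow]
    simp only [hdr₀, her, h]
  -- divide the root at index `0` by `ω`
  have k₀ : Fin n' := ⟨0, hn'⟩
  refine ⟨Function.update dr₀ k₀ (dr₀ k₀ * ω⁻¹), er, fun k => ?_, her, ?_⟩
  · by_cases hk : k = k₀
    · subst hk
      rw [Function.update_self, mul_pow, inv_pow, hωN, inv_one, mul_one, hdr₀]
    · rw [Function.update_of_ne hk, hdr₀]
  · rw [← Finset.mul_prod_erase Finset.univ _ (Finset.mem_univ k₀), Function.update_self,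
      Finset.prod_congr rfl (fun k hk => Function.update_of_ne (Finset.ne_of_mem_erase hk) _ _)]
    have hsplit : (∏ k, dr₀ k) = dr₀ k₀ * ∏ k ∈ Finset.univ.erase k₀, dr₀ k :=
      (Finset.mul_prod_erase Finset.univ _ (Finset.mem_univ k₀)).symm
    calc dr₀ k₀ * ω⁻¹ * (∏ k ∈ Finset.univ.erase k₀, dr₀ k) * ∏ l, er l
        = ((dr₀ k₀ * ∏ k ∈ Finset.univ.erase k₀, dr₀ k) * ∏ l, er l) * ω⁻¹ := by
          simp only [mul_comm, mul_left_comm, mul_assoc]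
      _ = 1 := by rw [← hsplit, ← hω, mul_inv_cancel]

end Summit.ValiantsHypothesis.ValiantsHypothesis.Theorems.FreeSubtorusOrbitDimensionBound.AbsorbingSacrifice
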